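import Literature.AnabelianGeometry.SemiGraphs.ApproximatorTransport
import Literature.AnabelianGeometry.SemiGraphs.ApproximatorImageProofs

/-!
# Transport of approximators along finite étale coverings — proofs ([SemiAnbd] §2, pp. 29–30)

Mochizuki, *Semi-graphs of anabelioids*, Publ. RIMS **42** (2006), §2 [cite: MochizukiSemiAnbd2006,
Prop. 2.6 p.29] ("by replacing `𝒢` by a finite étale covering of `𝒢`"; Cor. 2.7 p. 30), with
[GeoAn] §1.1 p. 14 (the image factorisation `X → I_φ → Y`).  For a morphism `φ' : 𝒢' → 𝒢` (e.g. a
finite étale covering) and a morphism `ψ : 𝒢 → 𝒢₀` into a semi-graph of anabelioids of bounded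
order (e.g. an approximator), the TRANSPORTED approximator of `𝒢'` is
`τ := (φ' ≫ ψ).toImageAnabelioids : 𝒢' → (φ' ≫ ψ).imageAnabelioids` (`ImageApproximator.lean`,
`HomComposition.lean`).  This proof-only file records the transfer lemmas the dictionary facts
(D5) `covering_isQuasiCoherent` and (D6) `covering_isElevated` (in their restated forms) consume:

* `transport_isPi1EpiApproximator` — `τ` is a `π₁`-epimorphic approximator whenever `𝒢₀` is of
  bounded order (no hypothesis on `φ'`, `ψ`);
* `ker_pi1Map_transport_φV` / `…_φE` — the kernel of `Π_{v'} → π₁(τ-target at v')` is the preimage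
  under `π₁(φ'_{v'})` of the kernel of `π₁(ψ_v)` (at the induced basepoint); hence the splitting
  transfer `transport_splits_of_comap_le`;
* `range_pi1Map_comp_φV` and `nonempty_aut_transport_mulEquiv_range` — the order transfer:
  `π₁` of the transported vertex constituent is `ψ_v(φ'_{v'}(Π_{v'})) ⊆ Π₀_v`;
* `pi1Map_fromImage_injective`, `fromImage_isPi1Mono` — the factor `I_φ → Y` is a
  `π₁`-monomorphism ([GeoAn] p. 14, "`π₁(X) ↠ π₁(I_φ) ↪ π₁(Y)`" as maps), through which the
  transported constituents embed into those of `𝒢₀`.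
-/

namespace Literature.AnabelianGeometry.Anabelioids

open CategoryTheory CategoryTheory.Limits CategoryTheory.PreGaloisCategory

universe w v₁ v₂ v₃ u₁ u₂ u₃

section Pi1MapComp

variable {X : Type u₁} [Category.{v₁} X] {Y : Type u₂} [Category.{v₂} Y] {Z : Type u₃}
  [Category.{v₃} Z]

/-- `π₁` of a composite of pull-back functors, as an equality of homomorphisms.
[cite: MochizukiGeoAn2004, Def. 1.1.2(ii) p.10] -/
theorem pi1Map_comp (Q : Z ⥤ Y) (P : Y ⥤ X) (F : X ⥤ FintypeCat.{w}) :
    pi1Map (Q ⋙ P) F = (pi1Map Q (P ⋙ F)).comp (pi1Map P F) := rfl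

/-- The image of `π₁` of a composite is the image of the image.
[cite: MochizukiGeoAn2004, Def. 1.1.2(ii) p.10] -/
theorem range_pi1Map_comp (Q : Z ⥤ Y) (P : Y ⥤ X) (F : X ⥤ FintypeCat.{w}) :
    (pi1Map (Q ⋙ P) F).range = (pi1Map P F).range.map (pi1Map Q (P ⋙ F)) :=
  MonoidHom.range_comp (pi1Map Q (P ⋙ F)) (pi1Map P F)

/-- The kernel of `π₁` of a composite is the preimage of the kernel.
[cite: MochizukiGeoAn2004, Def. 1.1.2(ii) p.10] -/
theorem ker_pi1Map_comp (Q : Z ⥤ Y) (P : Y ⥤ X) (F : X ⥤ FintypeCat.{w}) :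
    (pi1Map (Q ⋙ P) F).ker = (pi1Map Q (P ⋙ F)).ker.comap (pi1Map P F) :=
  (MonoidHom.comap_ker (pi1Map Q (P ⋙ F)) (pi1Map P F)).symm

end Pi1MapComp

section FromImage

variable {X : Type u₁} [Category.{v₁} X] {Y : Type u₂} [Category.{v₂} Y] [GaloisCategory X]
  [GaloisCategory Y] (φ : Hom X Y)

/-- **`π₁(I_φ) → π₁(Y)` is injective** at the basepoints `ι ∘ β` ([GeoAn] p. 14: the factorisation
`π₁(X) ↠ π₁(I_φ) ↪ π₁(Y)`): `π₁(X → I_φ)` is onto with the same kernel as `π₁(φ)`.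
[cite: MochizukiGeoAn2004, §1.1 p.14] -/
theorem pi1Map_fromImage_injective (F : X ⥤ FintypeCat.{v₁}) [FiberFunctor F] :
    Function.Injective (pi1Map (Hom.fromImage φ).pullback ((imageObj φ.pullback).ι ⋙ F)) := by
  intro τ₁ τ₂ h
  obtain ⟨σ₁, rfl⟩ := pi1Map_imageIncl_surjective φ F τ₁
  obtain ⟨σ₂, rfl⟩ := pi1Map_imageIncl_surjective φ F τ₂
  rw [← pi1Map_comp_apply, ← pi1Map_comp_apply] at h
  change pi1Map φ.pullback F σ₁ = pi1Map φ.pullback F σ₂ at h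
  have hmem : σ₁⁻¹ * σ₂ ∈ (pi1Map (imageObj φ.pullback).ι F).ker := by
    rw [← image_factorization_holds X Y φ F, MonoidHom.mem_ker, map_mul, map_inv, h,
      inv_mul_cancel]
  rw [MonoidHom.mem_ker, map_mul, map_inv, inv_mul_eq_one] at hmem
  exact hmem

/-- **`I_φ → Y` is a `π₁`-monomorphism** (at every basepoint of `I_φ`).
[cite: MochizukiGeoAn2004, §1.1 p.14] -/
theorem fromImage_isPi1Mono : IsPi1Mono (Hom.fromImage φ).pullback := by
  haveI : FiberFunctor ((imageObj φ.pullback).ι ⋙ GaloisCategory.getFiberFunctor X) :=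
    fiberFunctor_comp_of_exact _ _
  rw [isPi1Mono_iff_injective _ ((imageObj φ.pullback).ι ⋙ GaloisCategory.getFiberFunctor X)]
  exact pi1Map_fromImage_injective φ _

end FromImage

end Literature.AnabelianGeometry.Anabelioids

namespace Literature.AnabelianGeometry.SemiGraphs

open CategoryTheory CategoryTheory.Limits CategoryTheory.PreGaloisCategory
open Literature.AnabelianGeometry.Anabelioids

universe v₁ u₁ u

namespace SemiGraphOfAnabelioids

variable {𝒢' 𝒢 𝒢₀ : SemiGraphOfAnabelioids.{v₁, u₁, u}} (φ' : Hom 𝒢' 𝒢) (ψ : Hom 𝒢 𝒢₀)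

/-- **The transported approximator is a `π₁`-epimorphic approximator** of `𝒢'` as soon as `𝒢₀` is
of bounded order (for ANY `φ' : 𝒢' → 𝒢`, `ψ : 𝒢 → 𝒢₀`). [cite: MochizukiSemiAnbd2006, Prop. 2.6 p.29] -/
theorem transport_isPi1EpiApproximator (h₀ : 𝒢₀.IsOfBoundedOrder) :
    ((φ'.comp ψ).toImageAnabelioids).IsPi1EpiApproximator :=
  (φ'.comp ψ).toImageAnabelioids_isPi1EpiApproximator h₀

/-- The vertex components of the composite `φ' ≫ ψ` pull back by `ψ_v^* ⋙ φ'_{v'}^*`.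
[cite: MochizukiSemiAnbd2006, Rem. 2.4.2 p.26] -/
theorem comp_φV_pullback (v' : 𝒢'.graph.Vertex) :
    ((φ'.comp ψ).φV v').pullback = (ψ.φV (φ'.base.vertexMap v')).pullback ⋙ (φ'.φV v').pullback :=
  rfl

/-- The edge components of the composite `φ' ≫ ψ` (canonical index) pull back by `ψ_e^* ⋙ φ'_{e'}^*`.
[cite: MochizukiSemiAnbd2006, Rem. 2.4.2 p.26] -/
theorem comp_φE_pullback (e' : 𝒢'.graph.Edge) :
    ((φ'.comp ψ).φE e' ((φ'.comp ψ).base.edgeMap e') rfl).pullback =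
      (ψ.φE (φ'.base.edgeMap e') (ψ.base.edgeMap (φ'.base.edgeMap e')) rfl).pullback ⋙
        (φ'.φE e' (φ'.base.edgeMap e') rfl).pullback :=
  rfl

/-- **Kernel transfer at a vertex**: the kernel of `Π_{v'} → π₁` of the transported constituent is
the preimage under `π₁(φ'_{v'})` of the kernel of `π₁(ψ_v)` at the induced basepoint.
[cite: MochizukiSemiAnbd2006, Prop. 2.6 p.29] -/
theorem ker_pi1Map_transport_φV (v' : 𝒢'.graph.Vertex) (F' : 𝒢'.V v' ⥤ FintypeCat.{v₁})
    [FiberFunctor F'] :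
    (pi1Map (((φ'.comp ψ).toImageAnabelioids).φV v').pullback F').ker =
      ((pi1Map (ψ.φV (φ'.base.vertexMap v')).pullback ((φ'.φV v').pullback ⋙ F')).ker).comap
        (pi1Map (φ'.φV v').pullback F') := by
  refine Eq.trans (b := (pi1Map ((φ'.comp ψ).φV v').pullback F').ker) ?_ ?_
  · exact (image_factorization_holds _ _ ((φ'.comp ψ).φV v') F').symm
  · exact (MonoidHom.comap_ker (pi1Map (ψ.φV (φ'.base.vertexMap v')).pullback
      ((φ'.φV v').pullback ⋙ F')) (pi1Map (φ'.φV v').pullback F')).symm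

/-- **Kernel transfer at an edge.** [cite: MochizukiSemiAnbd2006, Prop. 2.6 p.29] -/
theorem ker_pi1Map_transport_φE (e' : 𝒢'.graph.Edge) (F' : 𝒢'.E e' ⥤ FintypeCat.{v₁})
    [FiberFunctor F'] :
    (pi1Map (((φ'.comp ψ).toImageAnabelioids).φE e'
        (((φ'.comp ψ).toImageAnabelioids).base.edgeMap e') rfl).pullback F').ker =
      ((pi1Map (ψ.φE (φ'.base.edgeMap e') (ψ.base.edgeMap (φ'.base.edgeMap e')) rfl).pullback
          ((φ'.φE e' (φ'.base.edgeMap e') rfl).pullback ⋙ F')).ker).comap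
        (pi1Map (φ'.φE e' (φ'.base.edgeMap e') rfl).pullback F') := by
  refine Eq.trans (b := (pi1Map ((φ'.comp ψ).φE e' ((φ'.comp ψ).base.edgeMap e') rfl).pullback
    F').ker) ?_ ?_
  · exact (image_factorization_holds _ _ ((φ'.comp ψ).φE e' _ rfl) F').symm
  · exact (MonoidHom.comap_ker (pi1Map (ψ.φE (φ'.base.edgeMap e')
      (ψ.base.edgeMap (φ'.base.edgeMap e')) rfl).pullback ((φ'.φE e' (φ'.base.edgeMap e') rfl).pullback
        ⋙ F')) (pi1Map (φ'.φE e' (φ'.base.edgeMap e') rfl).pullback F')).symm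

/-- **Splitting transfer**: the transported approximator splits a collection of coverings of `𝒢'`
whose open subgroups contain the preimages, under `π₁(φ'_{v'})` / `π₁(φ'_{e'})`, of the kernels of
`π₁(ψ)` at the induced basepoints. [cite: MochizukiSemiAnbd2006, Prop. 2.6 p.29] -/
theorem transport_splits_of_comap_le {M : ℕ} (𝒞 : CoveringCollection 𝒢' M)
    (hV : ∀ v', ((pi1Map (ψ.φV (φ'.base.vertexMap v')).pullback
        ((φ'.φV v').pullback ⋙ 𝒞.FV v')).ker).comap (pi1Map (φ'.φV v').pullback (𝒞.FV v')) ≤ 𝒞.UV v')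
    (hE : ∀ e', ((pi1Map (ψ.φE (φ'.base.edgeMap e') (ψ.base.edgeMap (φ'.base.edgeMap e')) rfl).pullback
        ((φ'.φE e' (φ'.base.edgeMap e') rfl).pullback ⋙ 𝒞.FE e')).ker).comap
          (pi1Map (φ'.φE e' (φ'.base.edgeMap e') rfl).pullback (𝒞.FE e')) ≤ 𝒞.UE e') :
    ((φ'.comp ψ).toImageAnabelioids).Splits 𝒞 := by
  haveI := 𝒞.fiberV
  haveI := 𝒞.fiberE
  exact ⟨fun v' => (ker_pi1Map_transport_φV φ' ψ v' (𝒞.FV v')).le.trans (hV v'),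
    fun e' => (ker_pi1Map_transport_φE φ' ψ e' (𝒞.FE e')).le.trans (hE e')⟩

/-- **Order transfer (range form)**: the image of `Π_{v'}` under `π₁` of the composite is
`ψ_v(φ'_{v'}(Π_{v'}))`. [cite: MochizukiSemiAnbd2006, Prop. 2.6 p.29] -/
theorem range_pi1Map_comp_φV (v' : 𝒢'.graph.Vertex) (F' : 𝒢'.V v' ⥤ FintypeCat.{v₁}) :
    (pi1Map ((φ'.comp ψ).φV v').pullback F').range =
      ((pi1Map (φ'.φV v').pullback F').range).map
        (pi1Map (ψ.φV (φ'.base.vertexMap v')).pullback ((φ'.φV v').pullback ⋙ F')) :=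
  MonoidHom.range_comp (pi1Map (ψ.φV (φ'.base.vertexMap v')).pullback ((φ'.φV v').pullback ⋙ F'))
    (pi1Map (φ'.φV v').pullback F')

/-- **Order transfer**: the fundamental group of the transported vertex constituent at `v'`, at the
basepoint `ι ∘ β'`, is isomorphic to `ψ_v(φ'_{v'}(Π_{v'})) ⊆ Π₀_v`.
[cite: MochizukiSemiAnbd2006, Prop. 2.6 p.29] -/
theorem nonempty_aut_transport_mulEquiv_range (v' : 𝒢'.graph.Vertex)
    (F' : 𝒢'.V v' ⥤ FintypeCat.{v₁}) [FiberFunctor F'] :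
    Nonempty (Aut ((imageObj ((φ'.comp ψ).φV v').pullback).ι ⋙ F') ≃*
      ((pi1Map (φ'.φV v').pullback F').range).map
        (pi1Map (ψ.φV (φ'.base.vertexMap v')).pullback ((φ'.φV v').pullback ⋙ F'))) := by
  obtain ⟨e⟩ := nonempty_aut_imageι_mulEquiv_range ((φ'.comp ψ).φV v') F'
  exact ⟨e.trans (MulEquiv.subgroupCongr (range_pi1Map_comp_φV φ' ψ v' F'))⟩

end SemiGraphOfAnabelioids

end Literature.AnabelianGeometry.SemiGraphs
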